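import Mathlib.RingTheory.RootsOfUnity.AlgebraicallyClosed
import Mathlib.GroupTheory.PGroup
import Literature.NumberTheory.Automorphic.TorusCharacters
import Literature.NumberTheory.Automorphic.TorusRigidity
import Literature.NumberTheory.Automorphic.LinearAlgebraicGroupsProofs
import HarnessLib

/-!
# Torsion points of tori: finiteness and Zariski density (Springer 3.2)
(trunk T-AUTOMORPHIC, G25 AutomorphicL)

Companion to `TorusCharacters.lean` (namespace `Literature.Automorphic`; concrete `k`-points
vocabulary: tori `IsTorusSubgroup T` in `GL n k`, algebraic characters, cocharacters, the
pairing `charPairingInt` with its dual bases `exists_dualBases_of_isTorusSubgroup`,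
Springer 3.2.11 (i)). For a prime `ℓ` invertible in `k`:

* `torsionBy T M` — the subgroup `T[M] = {t ∈ T | t ^ M = 1}` of a commutative `T ≤ GL n k`;
  `finite_torsionBy` (for `T` consisting of semisimple elements over an algebraically closed
  field: `T[M]` embeds into `μ_M(k)ⁿ` after diagonalisation), `isPGroup_torsionBy_pow`
  (`T[ℓ^j]` is an `ℓ`-group) and `exists_card_torsionBy_pow_eq` (its order is a power of `ℓ`,
  hence invertible in `k`);
* **`IsTorusSubgroup.le_of_forall_torsion_mem`** — **the `ℓ`-power torsion of a torus is
  Zariski dense**: an algebraic subgroup `H` containing `T[ℓ^j]` for all `j` contains `T`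
  (Springer 3.2: a character of `T` trivial on all `T[ℓ^j]` pairs to `0` with every
  cocharacter — `⟨χ, λ⟩` is divisible by every `ℓ^j`, using primitive `ℓ^j`-th roots of unity
  — hence is trivial by the perfect pairing 3.2.11 (i); and closed subgroups of `𝔻ₙ` are cut
  out by characters, 3.2.10 (4) `diagonalGL_mem_of_forall_diagChar`);
  corollary `IsTorusSubgroup.le_centralizer_of_forall_torsion` (an element commuting with all
  `ℓ`-power torsion of `T` centralises `T`); `isAlgebraicSubgroup_centralizer_set`.

These are the inputs "finite subgroups with dense union" of the finite-group approach to the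
conjugacy theorems of Springer 6.3.5 (`SolvableGroupTori.lean`).

## Mathlib

`IsPrimitiveRoot`, `HasEnoughRootsOfUnity` (instance for separably closed fields and `n`
invertible, `Mathlib.RingTheory.RootsOfUnity.AlgebraicallyClosed`), `rootsOfUnity` (finite),
`IsPGroup`, `IsPGroup.iff_card`.

## References

* T. A. Springer, *Linear Algebraic Groups*, 2nd ed., Progress in Mathematics 9, Birkhäuser
  (1998), 3.2.3, 3.2.7, 3.2.10 (4), 3.2.11 (i).
-/

open scoped MatrixGroups

namespace Literature.NumberTheory.Automorphic

open scoped Matrix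

variable {k : Type*} [Field k] {n : Type*} [Fintype n] [DecidableEq n]

attribute [local instance] zariskiTopologyGL

/-! ### Centralisers of sets are algebraic -/

section Centralizer

/-- **Centralisers are algebraic**: for any set `S ⊆ GL n k`, `Z(S) = {g | g s = s g ∀ s ∈ S}`
is an algebraic subgroup (each condition `g s g⁻¹ = s` is closed, conjugation being a polynomial
map; Springer 1.1.2). [folklore] -/
theorem isAlgebraicSubgroup_centralizer_set (S : Set (GL n k)) :
    IsAlgebraicSubgroup (Subgroup.centralizer S) := by
  rw [isAlgebraicSubgroup_iff_isClosed]
  have e : ((Subgroup.centralizer S : Subgroup (GL n k)) : Set (GL n k)) =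
      ⋂ s ∈ S, (fun g : GL n k => g * s * g⁻¹) ⁻¹' {s} := by
    ext g
    simp only [SetLike.mem_coe, Subgroup.mem_centralizer_iff, Set.mem_iInter, Set.mem_preimage,
      Set.mem_singleton_iff]
    refine forall₂_congr fun s _ => ?_
    rw [mul_inv_eq_iff_eq_mul, eq_comm]
  rw [e]
  exact isClosed_biInter fun s _ =>
    (isClosed_singleton_zariski s).preimage (isPolyMapGL_conj_apply s).continuous

end Centralizer

/-! ### Torsion subgroups of commutative subgroups -/

section Torsion

/-- The `M`-torsion `T[M] = {t ∈ T | t ^ M = 1}` of a commutative subgroup `T ≤ GL n k`, as a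
subgroup of `GL n k` (Mathlib has the additive `AddSubgroup.torsionBy A n = A[n]` of an abelian
group; here `T` sits in the non-commutative `GL n k`). [folklore] -/
def torsionBy (T : Subgroup (GL n k)) [IsMulCommutative ↥T] (M : ℕ) : Subgroup (GL n k) where
  carrier := {t | t ∈ T ∧ t ^ M = 1}
  one_mem' := ⟨T.one_mem, one_pow M⟩
  mul_mem' := by
    rintro a b ⟨ha, haM⟩ ⟨hb, hbM⟩
    refine ⟨T.mul_mem ha hb, ?_⟩
    have hc : Commute a b :=
      congrArg Subtype.val (IsMulCommutative.is_comm.comm (⟨a, ha⟩ : ↥T) ⟨b, hb⟩)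
    rw [hc.mul_pow, haM, hbM, one_mul]
  inv_mem' := by
    rintro a ⟨ha, haM⟩
    exact ⟨T.inv_mem ha, by rw [inv_pow, haM, inv_one]⟩

variable {T : Subgroup (GL n k)} [IsMulCommutative ↥T] {M : ℕ}

/-- Membership in `T[M]`. [folklore] -/
@[simp] lemma mem_torsionBy {t : GL n k} : t ∈ torsionBy T M ↔ t ∈ T ∧ t ^ M = 1 := Iff.rfl

/-- `T[M] ≤ T`. [folklore] -/
lemma torsionBy_le : torsionBy T M ≤ T := fun _ h => h.1

/-- `T[M] ≤ T[M']` when `M ∣ M'`. [folklore] -/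
lemma torsionBy_mono {M M' : ℕ} (h : M ∣ M') : torsionBy T M ≤ torsionBy T M' := by
  rintro t ⟨ht, htM⟩
  obtain ⟨c, rfl⟩ := h
  exact ⟨ht, by rw [pow_mul, htM, one_pow]⟩

/-- `T[ℓ^j]` is an `ℓ`-group. [folklore] -/
theorem isPGroup_torsionBy_pow (ℓ j : ℕ) : IsPGroup ℓ ↥(torsionBy T (ℓ ^ j)) := by
  intro t
  refine ⟨j, Subtype.ext ?_⟩
  have := t.2.2
  simpa using this

/-- **`T[M]` is finite** (`M ≠ 0`) for a commutative `T ≤ GL n k` of semisimple elements over an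
algebraically closed field: after simultaneous diagonalisation (`exists_conj_le_diagonalSubgroup`)
the diagonal entries embed `T[M]` into the finite group `μ_M(k)ⁿ`. [folklore] -/
theorem finite_torsionBy [IsAlgClosed k] (hss : ∀ t ∈ T, IsSemisimpleElt t) (hM : M ≠ 0) :
    Finite ↥(torsionBy T M) := by
  classical
  obtain ⟨g, hg⟩ := exists_conj_le_diagonalSubgroup (T := T) inferInstance hss
  haveI : NeZero M := ⟨hM⟩
  -- `t ↦ (diagonal entries of g t g⁻¹)` into `μ_M(k)ⁿ`
  have hdiag : ∀ t : ↥(torsionBy T M), ∃ d : n → kˣ,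
      diagonalGL n k d = g * (t : GL n k) * g⁻¹ ∧ ∀ i, d i ∈ rootsOfUnity M k := by
    intro t
    have ht : g * (t : GL n k) * g⁻¹ ∈ diagonalSubgroup n k :=
      hg ⟨t, t.2.1, rfl⟩
    obtain ⟨d, hd⟩ := ht
    refine ⟨d, hd, fun i => ?_⟩
    rw [mem_rootsOfUnity]
    have hpow : diagonalGL n k (d ^ M) = 1 := by
      rw [map_pow, hd, conj_pow, t.2.2, mul_one, mul_inv_cancel]
    have := congrFun (diagonalGL_injective (hpow.trans (map_one (diagonalGL n k)).symm)) i
    simpa using this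
  choose d hd hdμ using hdiag
  let f : ↥(torsionBy T M) → (n → ↥(rootsOfUnity M k)) := fun t i => ⟨d t i, hdμ t i⟩
  refine Finite.of_injective f fun t t' h => ?_
  have hdd : d t = d t' := funext fun i => congrArg Subtype.val (congrFun h i)
  have h1 := hd t
  rw [hdd, hd t'] at h1
  exact Subtype.ext (by simpa [mul_assoc] using h1.symm)

/-- The order of `T[ℓ^j]` is a power of `ℓ` (for `ℓ` prime and `T` of semisimple elements over
an algebraically closed field). [folklore] -/
theorem exists_card_torsionBy_pow_eq [IsAlgClosed k] (hss : ∀ t ∈ T, IsSemisimpleElt t)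
    {ℓ : ℕ} (hℓ : ℓ.Prime) (j : ℕ) : ∃ a : ℕ, Nat.card ↥(torsionBy T (ℓ ^ j)) = ℓ ^ a := by
  haveI : Fact ℓ.Prime := ⟨hℓ⟩
  haveI := finite_torsionBy (T := T) hss (M := ℓ ^ j) (pow_ne_zero j hℓ.ne_zero)
  exact IsPGroup.iff_card.1 (isPGroup_torsionBy_pow ℓ j)

end Torsion

/-! ### Density of the `ℓ`-power torsion of a torus -/

section Density

variable [IsAlgClosed k]

/-- A character of a torus `T` which is trivial on all `ℓ`-power torsion points pairs to zero
with every cocharacter: `χ (λ ζ) = ζ ^ ⟨χ, λ⟩ = 1` for all `ℓ^j`-th roots of unity `ζ` forces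
`ℓ^j ∣ ⟨χ, λ⟩` for all `j`. [folklore] -/
theorem charPairingInt_eq_zero_of_forall_torsion {T : Subgroup (GL n k)}
    [IsMulCommutative ↥T] {χ : ↥T →* kˣ} (hχ : IsAlgebraicChar χ) {ℓ : ℕ} (hℓ : ℓ.Prime)
    (hℓk : (ℓ : k) ≠ 0) (h : ∀ (j : ℕ) (t : ↥T), (t : GL n k) ^ ℓ ^ j = 1 → χ t = 1)
    {γ : kˣ →* ↥T} (hγ : IsAlgebraicCochar γ) : charPairingInt χ γ = 0 := by
  haveI : NeZero (ℓ : k) := ⟨hℓk⟩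
  set d := charPairingInt χ γ with hd
  have hdvd : ∀ j : ℕ, ((ℓ ^ j : ℕ) : ℤ) ∣ d := by
    intro j
    obtain ⟨ζ₀, hζ₀⟩ := HasEnoughRootsOfUnity.exists_primitiveRoot k (ℓ ^ j)
    have hζ := hζ₀.isUnit_unit (pow_ne_zero j hℓ.ne_zero)
    set ζ := (hζ₀.isUnit (pow_ne_zero j hℓ.ne_zero)).unit
    rw [← hζ.zpow_eq_one_iff_dvd, ← charPairingInt_spec_holds hχ hγ ζ]
    refine h j (γ ζ) ?_
    rw [← Subgroup.coe_pow, ← map_pow, hζ.pow_eq_one, map_one, Subgroup.coe_one]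
  by_contra hne
  obtain ⟨j, hj⟩ : ∃ j : ℕ, d.natAbs < ℓ ^ j := ⟨d.natAbs, Nat.lt_pow_self hℓ.one_lt⟩
  have h1 := Int.natAbs_dvd_natAbs.2 (hdvd j)
  rw [Int.natAbs_natCast] at h1
  exact absurd (Nat.le_of_dvd (Int.natAbs_pos.2 hne) h1) (not_le.2 hj)

/-- A character of a torus which is trivial on all `ℓ`-power torsion points is trivial (perfect
pairing, Springer 3.2.11 (i)). [cite: SpringerLAG1998, 3.2.11 (i)] -/
theorem char_eq_one_of_forall_torsion {T : Subgroup (GL n k)} (hT : IsTorusSubgroup T)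
    {χ : ↥T →* kˣ} (hχ : IsAlgebraicChar χ) {ℓ : ℕ} (hℓ : ℓ.Prime) (hℓk : (ℓ : k) ≠ 0)
    (h : ∀ (j : ℕ) (t : ↥T), (t : GL n k) ^ ℓ ^ j = 1 → χ t = 1) : χ = 1 := by
  haveI : IsMulCommutative ↥T := hT.2.1
  obtain ⟨r, bX, bY, hpair⟩ := exists_dualBases_of_isTorusSubgroup hT
  let χ' : ↥(characterLattice T) := ⟨χ, hχ⟩
  have hzero : bX (Additive.ofMul χ') = 0 := by
    funext i
    let γ : ↥(cocharacterLattice T) := Additive.toMul (bY.symm (Pi.single i 1))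
    have hp := hpair χ' γ
    have hγ : bY (Additive.ofMul γ) = Pi.single i 1 := by
      simp [γ]
    rw [hγ] at hp
    simp only [Pi.single_apply, mul_ite, mul_one, mul_zero, Finset.sum_ite_eq',
      Finset.mem_univ, if_true] at hp
    rw [← hp]
    exact charPairingInt_eq_zero_of_forall_torsion hχ hℓ hℓk h γ.2
  have hχ'1 : χ' = 1 := by
    have : Additive.ofMul χ' = 0 := by rw [← bX.map_eq_zero_iff]; exact hzero
    exact this
  exact congrArg Subtype.val hχ'1

/-- **The `ℓ`-power torsion of a torus is Zariski dense** (diagonal case): for a torus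
`T ≤ 𝔻ₙ` and an algebraic `H ≤ T` containing all `t ∈ T` of `ℓ`-power order (`ℓ` a prime
invertible in `k`), `H = T`. Closed subgroups of `𝔻ₙ` are cut out by monomial characters
(3.2.10 (4), `diagonalGL_mem_of_forall_diagChar`), and such a character trivial on `H` is trivial
on `T` (`char_eq_one_of_forall_torsion`). [cite: SpringerLAG1998, 3.2.10 (4) with 3.2.11 (i)] -/
theorem IsTorusSubgroup.le_of_forall_torsion_mem_of_le_diagonal {T H : Subgroup (GL n k)}
    (hT : IsTorusSubgroup T) (hTD : T ≤ diagonalSubgroup n k) (hH : IsAlgebraicSubgroup H)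
    (hHT : H ≤ T) {ℓ : ℕ} (hℓ : ℓ.Prime) (hℓk : (ℓ : k) ≠ 0)
    (h : ∀ (j : ℕ) (t : GL n k), t ∈ T → t ^ ℓ ^ j = 1 → t ∈ H) : T ≤ H := by
  intro t ht
  obtain ⟨d, rfl⟩ := hTD ht
  have hHD : H ≤ diagonalSubgroup n k := hHT.trans hTD
  refine diagonalGL_mem_of_forall_diagChar hH hHD d fun m hm => ?_
  -- the monomial character `χₘ` on `T` is trivial on `H`, hence on `T`
  have hχ1 : diagChar hTD m = 1 := by
    refine char_eq_one_of_forall_torsion hT (diagChar_mem_characterLattice hTD m) hℓ hℓk ?_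
    intro j s hs
    have hsH : (s : GL n k) ∈ H := h j s s.2 hs
    have e : diagChar hTD m s = diagChar hHD m ⟨s, hsH⟩ := by
      rw [diagChar_apply, diagChar_apply]
      refine Finset.prod_congr rfl fun i _ => ?_
      have hi : diagCoord hTD s i = diagCoord hHD ⟨(s : GL n k), hsH⟩ i :=
        Units.ext rfl
      rw [hi]
    rw [e, hm, MonoidHom.one_apply]
  have ht1 := DFunLike.congr_fun hχ1 ⟨diagonalGL n k d, ht⟩
  rw [diagChar_apply, MonoidHom.one_apply] at ht1
  rw [← ht1]
  refine Finset.prod_congr rfl fun i _ => ?_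
  congr 1
  have := diagonalGL_diagCoord hTD ⟨diagonalGL n k d, ht⟩
  exact (congrFun (diagonalGL_injective this) i).symm

/-- **The `ℓ`-power torsion of a torus is Zariski dense**: if `T ≤ GL n k` is a torus over an
algebraically closed field, `ℓ` a prime invertible in `k`, and `H` an algebraic subgroup
containing every `t ∈ T` of `ℓ`-power order, then `T ≤ H` (reduce to `T ≤ 𝔻ₙ` by conjugation,
`exists_conj_le_diagonalSubgroup`, and to `H ≤ T` by intersecting).
[cite: SpringerLAG1998, 3.2.10 (4) with 3.2.11 (i)] -/
theorem IsTorusSubgroup.le_of_forall_torsion_mem {T H : Subgroup (GL n k)}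
    (hT : IsTorusSubgroup T) (hH : IsAlgebraicSubgroup H) {ℓ : ℕ} (hℓ : ℓ.Prime)
    (hℓk : (ℓ : k) ≠ 0) (h : ∀ (j : ℕ) (t : GL n k), t ∈ T → t ^ ℓ ^ j = 1 → t ∈ H) :
    T ≤ H := by
  -- intersect with `T`
  suffices hsuff : T ≤ H ⊓ T from fun t ht => (hsuff ht).1
  have hH' : IsAlgebraicSubgroup (H ⊓ T) := hH.inf hT.1.1
  have h' : ∀ (j : ℕ) (t : GL n k), t ∈ T → t ^ ℓ ^ j = 1 → t ∈ H ⊓ T :=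
    fun j t ht htj => ⟨h j t ht htj, ht⟩
  -- conjugate into the diagonal torus
  obtain ⟨g, hg⟩ := exists_conj_le_diagonalSubgroup hT.2.1 hT.2.2
  set c : GL n k →* GL n k := (MulAut.conj g).toMonoidHom with hc
  have hT₁ : IsTorusSubgroup (T.map c) := hT.map_conj g
  have hH₁ : IsAlgebraicSubgroup ((H ⊓ T).map c) := hH'.map_conj' g
  have hle : T.map c ≤ (H ⊓ T).map c := by
    refine hT₁.le_of_forall_torsion_mem_of_le_diagonal hg hH₁ (Subgroup.map_mono inf_le_right)
      hℓ hℓk ?_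
    rintro j _ ⟨t, ht, rfl⟩ htj
    refine ⟨t, h' j t ht ?_, rfl⟩
    have e : c t ^ ℓ ^ j = c (t ^ ℓ ^ j) := (map_pow c t _).symm
    rw [e, show (1 : GL n k) = c 1 from (map_one c).symm] at htj
    exact (MulAut.conj g).injective htj
  intro t ht
  have := hle ⟨t, ht, rfl⟩
  obtain ⟨t', ht', htt'⟩ := this
  rwa [← (MulAut.conj g).injective htt']

/-- **An element commuting with all `ℓ`-power torsion points of a torus centralises the torus.**
[cite: SpringerLAG1998, 3.2.10 (4) with 3.2.11 (i)] -/
theorem IsTorusSubgroup.le_centralizer_of_forall_torsion {T : Subgroup (GL n k)}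
    (hT : IsTorusSubgroup T) {ℓ : ℕ} (hℓ : ℓ.Prime) (hℓk : (ℓ : k) ≠ 0) {x : GL n k}
    (h : ∀ (j : ℕ) (t : GL n k), t ∈ T → t ^ ℓ ^ j = 1 → t * x = x * t) :
    T ≤ Subgroup.centralizer {x} :=
  hT.le_of_forall_torsion_mem (isAlgebraicSubgroup_centralizer_set {x}) hℓ hℓk
    fun j t ht htj => Subgroup.mem_centralizer_singleton_iff.2 (h j t ht htj)

end Density

end Literature.NumberTheory.Automorphic
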